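import Summits.Ventures.WeilGRH.UniformConductorFloorJointCells
import Summits.Ventures.WeilGRH.UniformConductorFloorCoprimeMinorant
import HarnessLib

/-!
# GRH arm (rh-explicit, venture WeilGRH): the joint cell certificate with GENERAL prime weights — divisibility floors

Cell `rh-explicit`, WEIL TRACK — GRH ARM (weil-grh-1, gen7 «divisibility floors»).
`UniformConductorFloorJointCells.lean` proves the joint (archimedean layers + primes) Collatz–Wielandt bound
`T_M(|g|) ≥ (log q − log π + ψ(x) + 2Σ_k I_k − ρ)‖g‖²` for the all-trivial-key form, whose prime weights are `Λ(n)/√n`, from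
a certificate with weights `w̄_n ≥ Λ(n)/√n`.  The proof uses `Λ(n)/√n` only through `0 ≤ Λ(n)/√n ≤ w̄_n`; this file records
the SAME bound for arbitrary prime weights `0 ≤ w_n ≤ w̄_n` (`trivialKeyFormTrunc_add_ge_of_joint_cert`, proof verbatim;
the form with weights `w` is written `T_M(h) + Σ_n (Λ(n)/√n − w_n)·2c_h(log n)`, no new definition), and the consequence
for the weight `Λ(n)/√n·[(n, m) = 1]` (`weilPositivityOnChar_of_joint_cert_coprime`): a joint cell certificate whose prime
weights dominate `Λ(n)/√n` only on the prime powers `n ≤ N` PRIME TO `m` gives `WeilPositivityOnChar χ t` for every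
character of parity `κ` of every modulus `q ≥ Q₀` DIVISIBLE BY `m` — the divisibility floor `q*(t; m)` (the characters of
such a modulus vanish on the `n` with `(n, m) > 1`, `UniformConductorFloorCoprimeMinorant.lean`).

Everything here is PROVED; no definitions, no named facts; no `ζ` input; standard axioms.

## References

* A. Weil (1952), (11) pp. 261–262 and the «lemme» p. 262 [Weil1952FormulesExplicites]; H. L. Montgomery, R. C. Vaughan (2007),
  (12.22) [MontgomeryVaughan2007]; L. Collatz (1942) / H. Wielandt (1950). [folklore]
-/

noncomputable section

open Complex Filter Set MeasureTheory
open scoped Real Topology ComplexConjugate ArithmeticFunction.vonMangoldt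

namespace Summit.Ventures.WeilGRH

open Literature.NumberTheory.LFunctions

namespace UniformFloor

variable {g : ℝ → ℂ}

/-! ## The joint certificate for general prime weights -/

/-- **JOINT CELL CERTIFICATE ⇒ LOWER BOUND FOR THE FORM WITH PRIME WEIGHTS `0 ≤ w_n ≤ w̄_n`** (the statement and proof
of `trivialKeyFormTrunc_ge_of_joint_cert` with `Λ(n)/√n` replaced by `w n`; the form is `T_M(h) + Σ_n (Λ(n)/√n − w_n)·2c_h(log n)`).  Cells `δ = 2t/J`, a step vector `φ`
(`Φ₀ ≤ φ_i ≤ Φ₁` on `[0, J)`, `0` outside), prime shifts `s_n` (`s_nδ ≤ log n ≤ (s_n+1)δ`) and weights `w̄_n ≥ Λ(n)/√n`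
(`n ≤ N`), `M` Lévy layers of parameter `x > 0`, slabs `k0 ≤ k < K` with mass bounds
`Σ_{m<M} ∫_{kδ}^{(k+1)δ} e^{−2(m+x)|u|} du ≤ Ī_k`.  If for every `0 ≤ j < J`
`Σ_n w̄_n [max(φ_{j−s_n−1},φ_{j−s_n}) + max(φ_{j+s_n},φ_{j+s_n+1})] + Σ_k Ī_k [max(φ_{j−k−1},φ_{j−k}) + max(φ_{j+k},φ_{j+k+1})] ≤ ρ φ_j`
then for every test function `g` supported in `[-t, t]`:
`(log q − log π + ψ(x) + 2Σ_k Σ_m ∫_{kδ}^{(k+1)δ} e^{−2(m+x)|u|}du − ρ) ‖g‖₂² ≤ T_M(|g|) + Σ_n (Λ(n)/√n − w_n)·2∫|g(y)||g(y − log n)|dy`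
(`T_M = trivialKeyFormTrunc x q N M`).
[cite: Weil1952FormulesExplicites, (11) pp. 261–262; MontgomeryVaughan2007, (12.22)] -/
theorem trivialKeyFormTrunc_add_ge_of_joint_cert (hg : IsWeilTest g) {t : ℝ} (ht : 0 < t)
    (hsupp : tsupport g ⊆ Icc (-t) t) {J : ℕ} (hJ : 0 < J) (φ : ℤ → ℝ) {Φ₀ Φ₁ : ℝ} (hΦ₀ : 0 < Φ₀)
    (hφlo : ∀ i, 0 ≤ i → i < (J : ℤ) → Φ₀ ≤ φ i) (hφhi : ∀ i, φ i ≤ Φ₁)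
    (hφout : ∀ i, i < 0 ∨ (J : ℤ) ≤ i → φ i = 0) (N : ℕ) (s : ℕ → ℕ)
    (hs : ∀ n ∈ Finset.range (N + 1),
      ((s n : ℤ) : ℝ) * (2 * t / J) ≤ Real.log n ∧ Real.log n ≤ (((s n : ℤ) : ℝ) + 1) * (2 * t / J))
    (w : ℕ → ℝ) (hw0 : ∀ n, 0 ≤ w n) (wbar : ℕ → ℝ) (hw : ∀ n ∈ Finset.range (N + 1), w n ≤ wbar n)
    {x : ℝ} (hx : 0 < x) (M : ℕ) {k0 K : ℕ} (hk : k0 ≤ K) (Ibar : ℕ → ℝ)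
    (hI : ∀ k ∈ Finset.Ico k0 K, ∑ m ∈ Finset.range M,
      ∫ u in ((k : ℝ) * (2 * t / J))..(((k : ℝ) + 1) * (2 * t / J)), Real.exp (-(2 * ((m : ℝ) + x) * |u|)) ≤ Ibar k)
    {ρ : ℝ}
    (hcert : ∀ j ∈ Finset.range J,
      ∑ n ∈ Finset.range (N + 1), wbar n *
          (max (φ ((j : ℤ) - s n - 1)) (φ ((j : ℤ) - s n)) + max (φ ((j : ℤ) + s n)) (φ ((j : ℤ) + s n + 1))) +
        ∑ k ∈ Finset.Ico k0 K, Ibar k *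
          (max (φ ((j : ℤ) - k - 1)) (φ ((j : ℤ) - k)) + max (φ ((j : ℤ) + k)) (φ ((j : ℤ) + k + 1))) ≤
        ρ * φ (j : ℤ)) (q : ℕ) :
    (Real.log q - Real.log π + (digamma (x : ℂ)).re +
        2 * (∑ k ∈ Finset.Ico k0 K, ∑ m ∈ Finset.range M,
          ∫ u in ((k : ℝ) * (2 * t / J))..(((k : ℝ) + 1) * (2 * t / J)), Real.exp (-(2 * ((m : ℝ) + x) * |u|))) - ρ) *
        weilNorm2Sq g ≤
      trivialKeyFormTrunc x q N M (fun y ↦ ‖g y‖) +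
        ∑ n ∈ Finset.range (N + 1), ((Λ n : ℝ) / Real.sqrt n - w n) *
          (2 * ∫ y : ℝ, ‖g y‖ * ‖g (y - Real.log n)‖) := by
  set δ : ℝ := 2 * t / J with hδdef
  have hδ : 0 < δ := by positivity
  have hgc : Continuous g := hg.1.continuous
  set N2 := weilNorm2Sq g with hN2
  have hN2eq : (∫ y : ℝ, ‖g y‖ ^ 2) = N2 := rfl
  have hN20 : 0 ≤ N2 := integral_nonneg fun _ ↦ by positivity
  set c : ℝ → ℝ := fun u ↦ ∫ y : ℝ, ‖g y‖ * ‖g (y - u)‖ with hc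
  -- the cell weights (one per shift index)
  set V : ℕ → ℤ → ℝ := fun r j ↦
    (max (φ (j - r - 1)) (φ (j - r)) + max (φ (j + r)) (φ (j + r + 1))) / φ j with hV
  have hφ0 : ∀ i, 0 ≤ φ i := by
    intro i
    rcases lt_or_ge i 0 with h | h
    · rw [hφout i (Or.inl h)]
    · rcases lt_or_ge i (J : ℤ) with h' | h'
      · exact hΦ₀.le.trans (hφlo i h h')
      · rw [hφout i (Or.inr h')]
  have hΦ₁ : 0 < Φ₁ := by
    have h0 := hφlo 0 le_rfl (by exact_mod_cast hJ)
    linarith [hφhi 0]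
  have hVbd : ∀ r j, |V r j| ≤ 2 * Φ₁ / Φ₀ := by
    intro r j
    have hnum0 : 0 ≤ max (φ (j - r - 1)) (φ (j - r)) + max (φ (j + r)) (φ (j + r + 1)) :=
      add_nonneg ((hφ0 _).trans (le_max_left _ _)) ((hφ0 _).trans (le_max_left _ _))
    have hnum1 : max (φ (j - r - 1)) (φ (j - r)) + max (φ (j + r)) (φ (j + r + 1)) ≤ 2 * Φ₁ := by
      have := max_le (hφhi (j - r - 1)) (hφhi (j - r))
      have := max_le (hφhi (j + r)) (hφhi (j + r + 1))
      linarith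
    rcases lt_or_ge j 0 with h | h
    · simp only [hV, hφout j (Or.inl h), div_zero, abs_zero]; positivity
    rcases lt_or_ge j (J : ℤ) with h' | h'
    · have hφj : 0 < φ j := hΦ₀.trans_le (hφlo j h h')
      simp only [hV]
      rw [abs_of_nonneg (div_nonneg hnum0 hφj.le), div_le_div_iff₀ hφj hΦ₀]
      calc _ ≤ 2 * Φ₁ * Φ₀ := mul_le_mul_of_nonneg_right hnum1 hΦ₀.le
        _ ≤ 2 * Φ₁ * φ j := mul_le_mul_of_nonneg_left (hφlo j h h') (by positivity)
    · simp only [hV, hφout j (Or.inr h'), div_zero, abs_zero]; positivity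
  have hV0 : ∀ r j, 0 ≤ V r j := fun r j ↦
    div_nonneg (add_nonneg ((hφ0 _).trans (le_max_left _ _)) ((hφ0 _).trans (le_max_left _ _))) (hφ0 j)
  have hIV : ∀ r, Integrable fun x : ℝ ↦ V r ⌊(x + t) / δ⌋ * ‖g x‖ ^ 2 := by
    intro r
    simpa only [sub_zero] using integrable_step_mul hg (V r) (hVbd r) t δ 0
  have hIV0 : ∀ r, 0 ≤ ∫ x : ℝ, V r ⌊(x + t) / δ⌋ * ‖g x‖ ^ 2 := fun r ↦
    integral_nonneg fun x ↦ mul_nonneg (hV0 r _) (by positivity)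
  -- (P) the prime side, shift by shift
  have hshift : ∀ n ∈ Finset.range (N + 1),
      w n * (2 * c (Real.log n)) ≤ wbar n * ∫ x : ℝ, V (s n) ⌊(x + t) / δ⌋ * ‖g x‖ ^ 2 := by
    intro n hn
    have hΛ : 0 ≤ w n := hw0 n
    have h2 := two_mul_integral_le_of_phi hg ht hsupp hJ φ hΦ₀ hφlo hφhi hφout
      (L := Real.log n) (s := (s n : ℤ)) (by positivity) (hs n hn).1 (hs n hn).2
    have hkk : 2 * c (Real.log n) ≤ ∫ x : ℝ, V (s n) ⌊(x + t) / δ⌋ * ‖g x‖ ^ 2 := by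
      simpa only [hV, hδdef, hc] using h2
    have h0 : 0 ≤ 2 * c (Real.log n) := by
      have := integral_norm_mul_norm_shift_nonneg g (Real.log n); simp only [hc]; linarith
    calc w n * (2 * c (Real.log n)) ≤ wbar n * (2 * c (Real.log n)) :=
          mul_le_mul_of_nonneg_right (hw n hn) h0
      _ ≤ wbar n * ∫ x : ℝ, V (s n) ⌊(x + t) / δ⌋ * ‖g x‖ ^ 2 :=
          mul_le_mul_of_nonneg_left hkk (hΛ.trans (hw n hn))
  have hP : ∑ n ∈ Finset.range (N + 1), w n * (2 * c (Real.log n)) ≤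
      ∑ n ∈ Finset.range (N + 1), wbar n * ∫ x : ℝ, V (s n) ⌊(x + t) / δ⌋ * ‖g x‖ ^ 2 :=
    Finset.sum_le_sum hshift
  -- (A) the archimedean layers, slab by slab
  have hlayer : ∀ m ∈ Finset.range M,
      2 * ∑ k ∈ Finset.Ico k0 K, (∫ u in ((k : ℝ) * δ)..(((k : ℝ) + 1) * δ), Real.exp (-(2 * ((m : ℝ) + x) * |u|))) *
          (N2 - 1 / 2 * ∫ y : ℝ, V k ⌊(y + t) / δ⌋ * ‖g y‖ ^ 2) ≤
        ∫ u : ℝ, Real.exp (-(2 * ((m : ℝ) + x) * |u|)) * (N2 - c u) := by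
    intro m _
    have hl : 0 < (m : ℝ) + x := by positivity
    set f : ℝ → ℝ := fun u ↦ Real.exp (-(2 * ((m : ℝ) + x) * |u|)) * (N2 - c u) with hf
    have hfI : Integrable f := integrable_layer_integrand hg hl
    have h1 := layer_ge_two_mul hg hl (a := (k0 : ℝ) * δ) (b := (K : ℝ) * δ) (by positivity)
      (mul_le_mul_of_nonneg_right (by exact_mod_cast hk) hδ.le)
    have h2 := integral_eq_sum_slabs hfI (δ := δ) hk
    have h3 : ∀ k ∈ Finset.Ico k0 K,
        (∫ u in ((k : ℝ) * δ)..(((k : ℝ) + 1) * δ), Real.exp (-(2 * ((m : ℝ) + x) * |u|))) *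
            (N2 - 1 / 2 * ∫ y : ℝ, V k ⌊(y + t) / δ⌋ * ‖g y‖ ^ 2) ≤
          ∫ u in ((k : ℝ) * δ)..(((k : ℝ) + 1) * δ), f u := by
      intro k _
      have hEc : Continuous fun u : ℝ ↦ Real.exp (-(2 * ((m : ℝ) + x) * |u|)) :=
        Real.continuous_exp.comp ((continuous_const.mul continuous_abs).neg)
      have h := slab_ge hg ht hsupp hJ φ hΦ₀ hφlo hφhi hφout k
        (w := fun u ↦ Real.exp (-(2 * ((m : ℝ) + x) * |u|))) (fun u _ ↦ (Real.exp_pos _).le)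
        (hEc.intervalIntegrable _ _)
        (by have hh := hfI.intervalIntegrable (μ := volume) (a := (k : ℝ) * δ) (b := ((k : ℝ) + 1) * δ)
            simpa only [hf, hc] using hh)
      simpa only [hV, hδdef, hf, hc] using h
    have h4 := Finset.sum_le_sum h3
    rw [← h2] at h4
    linarith
  have hA := Finset.sum_le_sum hlayer
  -- rewrite the left side of (A): Σ_m 2 Σ_k I_{m,k} (N2 - X_k/2) = 2 (Σ_k Σ_m I_{m,k}) N2 - Σ_k (Σ_m I_{m,k}) X_k
  set I : ℕ → ℕ → ℝ := fun m k ↦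
    ∫ u in ((k : ℝ) * δ)..(((k : ℝ) + 1) * δ), Real.exp (-(2 * ((m : ℝ) + x) * |u|)) with hIdef
  set Xk : ℕ → ℝ := fun k ↦ ∫ y : ℝ, V k ⌊(y + t) / δ⌋ * ‖g y‖ ^ 2 with hXk
  have eA : ∑ m ∈ Finset.range M, 2 * ∑ k ∈ Finset.Ico k0 K, I m k * (N2 - 1 / 2 * Xk k) =
      2 * (∑ k ∈ Finset.Ico k0 K, ∑ m ∈ Finset.range M, I m k) * N2 -
        ∑ k ∈ Finset.Ico k0 K, (∑ m ∈ Finset.range M, I m k) * Xk k := by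
    calc ∑ m ∈ Finset.range M, 2 * ∑ k ∈ Finset.Ico k0 K, I m k * (N2 - 1 / 2 * Xk k)
        = ∑ m ∈ Finset.range M, ∑ k ∈ Finset.Ico k0 K, (2 * N2 * I m k - Xk k * I m k) := by
          refine Finset.sum_congr rfl fun m _ ↦ ?_
          rw [Finset.mul_sum]
          exact Finset.sum_congr rfl fun k _ ↦ by ring
      _ = ∑ k ∈ Finset.Ico k0 K, ∑ m ∈ Finset.range M, (2 * N2 * I m k - Xk k * I m k) := Finset.sum_comm
      _ = ∑ k ∈ Finset.Ico k0 K,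
            (2 * N2 * ∑ m ∈ Finset.range M, I m k - Xk k * ∑ m ∈ Finset.range M, I m k) := by
          refine Finset.sum_congr rfl fun k _ ↦ ?_
          rw [Finset.sum_sub_distrib, Finset.mul_sum, Finset.mul_sum]
      _ = 2 * N2 * ∑ k ∈ Finset.Ico k0 K, ∑ m ∈ Finset.range M, I m k -
            ∑ k ∈ Finset.Ico k0 K, Xk k * ∑ m ∈ Finset.range M, I m k := by
          rw [Finset.sum_sub_distrib, Finset.mul_sum]
      _ = _ := by
          congr 1
          · ring
          · exact Finset.sum_congr rfl fun k _ ↦ mul_comm _ _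
  have hA' : 2 * (∑ k ∈ Finset.Ico k0 K, ∑ m ∈ Finset.range M, I m k) * N2 -
      ∑ k ∈ Finset.Ico k0 K, Ibar k * Xk k ≤
      ∑ m ∈ Finset.range M, ∫ u : ℝ, Real.exp (-(2 * ((m : ℝ) + x) * |u|)) * (N2 - c u) := by
    have hIX : ∑ k ∈ Finset.Ico k0 K, (∑ m ∈ Finset.range M, I m k) * Xk k ≤
        ∑ k ∈ Finset.Ico k0 K, Ibar k * Xk k :=
      Finset.sum_le_sum fun k hkk ↦ mul_le_mul_of_nonneg_right (by simpa only [hIdef] using hI k hkk) (hIV0 k)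
    have hA2 : ∑ m ∈ Finset.range M, 2 * ∑ k ∈ Finset.Ico k0 K, I m k * (N2 - 1 / 2 * Xk k) ≤
        ∑ m ∈ Finset.range M, ∫ u : ℝ, Real.exp (-(2 * ((m : ℝ) + x) * |u|)) * (N2 - c u) := by
      simpa only [hIdef, hXk] using hA
    rw [eA] at hA2
    linarith
  -- (C) the certificate, pointwise in `x`
  have hI : Integrable (fun u : ℝ ↦ ‖g u‖ ^ 2) := by
    refine (hgc.norm.pow 2).integrable_of_hasCompactSupport ?_
    rw [pow_two]
    exact hg.2.norm.mul_right
  have hpt : ∀ y : ℝ, (∑ n ∈ Finset.range (N + 1), wbar n * (V (s n) ⌊(y + t) / δ⌋ * ‖g y‖ ^ 2) +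
      ∑ k ∈ Finset.Ico k0 K, Ibar k * (V k ⌊(y + t) / δ⌋ * ‖g y‖ ^ 2)) ≤ ρ * ‖g y‖ ^ 2 := by
    intro y
    by_cases hgy : g y = 0
    · simp [hgy]
    have hyI := mem_Ioo_of_ne_zero hg hsupp hgy
    obtain ⟨hj0, hjJ⟩ := floor_mem_range ht hJ hyI
    rw [← hδdef] at hj0 hjJ
    set j := ⌊(y + t) / δ⌋ with hj
    have hφj : 0 < φ j := hΦ₀.trans_le (hφlo j hj0 hjJ)
    have hcj := hcert j.toNat (Finset.mem_range.2 (by omega))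
    rw [Int.toNat_of_nonneg hj0] at hcj
    have e : (∑ n ∈ Finset.range (N + 1), wbar n * (V (s n) j * ‖g y‖ ^ 2) +
        ∑ k ∈ Finset.Ico k0 K, Ibar k * (V k j * ‖g y‖ ^ 2)) =
        (∑ n ∈ Finset.range (N + 1), wbar n *
            (max (φ (j - s n - 1)) (φ (j - s n)) + max (φ (j + s n)) (φ (j + s n + 1))) +
          ∑ k ∈ Finset.Ico k0 K, Ibar k *
            (max (φ (j - k - 1)) (φ (j - k)) + max (φ (j + k)) (φ (j + k + 1)))) / φ j * ‖g y‖ ^ 2 := by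
      rw [add_div, add_mul, Finset.sum_div, Finset.sum_div, Finset.sum_mul, Finset.sum_mul]
      congr 1 <;> refine Finset.sum_congr rfl fun n _ ↦ ?_ <;> simp only [hV] <;> ring
    rw [e]
    refine mul_le_mul_of_nonneg_right ?_ (by positivity)
    rw [div_le_iff₀ hφj]
    exact hcj
  have hIsum : Integrable fun y : ℝ ↦ (∑ n ∈ Finset.range (N + 1), wbar n * (V (s n) ⌊(y + t) / δ⌋ * ‖g y‖ ^ 2) +
      ∑ k ∈ Finset.Ico k0 K, Ibar k * (V k ⌊(y + t) / δ⌋ * ‖g y‖ ^ 2)) :=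
    (integrable_finsetSum _ fun n _ ↦ (hIV (s n)).const_mul (wbar n)).add
      (integrable_finsetSum _ fun k _ ↦ (hIV k).const_mul (Ibar k))
  have hfin := integral_mono hIsum (hI.const_mul ρ) hpt
  rw [integral_add (integrable_finsetSum _ fun n _ ↦ (hIV (s n)).const_mul (wbar n))
    (integrable_finsetSum _ fun k _ ↦ (hIV k).const_mul (Ibar k)),
    integral_finsetSum _ (fun n _ ↦ (hIV (s n)).const_mul (wbar n)),
    integral_finsetSum _ (fun k _ ↦ (hIV k).const_mul (Ibar k)), integral_const_mul] at hfin
  simp only [integral_const_mul] at hfin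
  -- hfin : Σ_n wbar n * Xs n + Σ_k Ibar k * Xk k ≤ ρ * N2
  -- assemble
  simp only [trivialKeyFormTrunc]
  rw [hN2eq]
  have hXs : ∑ n ∈ Finset.range (N + 1), w n * (2 * ∫ y : ℝ, ‖g y‖ * ‖g (y - Real.log n)‖) ≤
      ∑ n ∈ Finset.range (N + 1), wbar n * ∫ x : ℝ, V (s n) ⌊(x + t) / δ⌋ * ‖g x‖ ^ 2 := by
    simpa only [hc] using hP
  have hAA : 2 * (∑ k ∈ Finset.Ico k0 K, ∑ m ∈ Finset.range M, I m k) * N2 -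
      ∑ k ∈ Finset.Ico k0 K, Ibar k * Xk k ≤
      ∑ m ∈ Finset.range M, ∫ u : ℝ, Real.exp (-(2 * ((m : ℝ) + x) * |u|)) *
        (N2 - ∫ y : ℝ, ‖g y‖ * ‖g (y - u)‖) := by
    simpa only [hc] using hA'
  have hfin' : (∑ n ∈ Finset.range (N + 1), wbar n * ∫ x : ℝ, V (s n) ⌊(x + t) / δ⌋ * ‖g x‖ ^ 2) +
      ∑ k ∈ Finset.Ico k0 K, Ibar k * Xk k ≤ ρ * N2 := by
    simp only [hXk]
    rw [← hN2eq]
    exact hfin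
  simp only [hIdef] at hAA
  have key : (Real.log q - Real.log π + (digamma (x : ℂ)).re +
        2 * (∑ k ∈ Finset.Ico k0 K, ∑ m ∈ Finset.range M,
          ∫ u in ((k : ℝ) * δ)..(((k : ℝ) + 1) * δ), Real.exp (-(2 * ((m : ℝ) + x) * |u|))) - ρ) * N2 =
      (Real.log q - Real.log π + (digamma (x : ℂ)).re) * N2 +
        2 * (∑ k ∈ Finset.Ico k0 K, ∑ m ∈ Finset.range M,
          ∫ u in ((k : ℝ) * δ)..(((k : ℝ) + 1) * δ), Real.exp (-(2 * ((m : ℝ) + x) * |u|))) * N2 - ρ * N2 := by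
    ring
  rw [key]
  have hS : ∑ n ∈ Finset.range (N + 1), ((Λ n : ℝ) / Real.sqrt n - w n) * (2 * ∫ y : ℝ, ‖g y‖ * ‖g (y - Real.log n)‖) =
      ∑ n ∈ Finset.range (N + 1), (Λ n : ℝ) / Real.sqrt n * (2 * ∫ y : ℝ, ‖g y‖ * ‖g (y - Real.log n)‖) -
        ∑ n ∈ Finset.range (N + 1), w n * (2 * ∫ y : ℝ, ‖g y‖ * ‖g (y - Real.log n)‖) := by
    rw [← Finset.sum_sub_distrib]
    exact Finset.sum_congr rfl fun n _ ↦ by ring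
  rw [hS]
  linarith [hXs, hAA, hfin']

/-- **DIVISIBILITY FLOOR FROM A JOINT CELL CERTIFICATE.**  For `χ` mod `q ≠ 1` of parity `κ` (`x = 1/4 + κ/2`) with `m ∣ q`,
a window `t > 0` with `e^{2t} ≤ N + 1`, a joint certificate as in `trivialKeyFormTrunc_add_ge_of_joint_cert` whose weights
satisfy `Λ(n)/√n ≤ w̄_n` on the `n ≤ N` PRIME TO `m` and `0 ≤ w̄_n` on the others, budget `ρ`, a constant
`C ≤ 2Σ_k Σ_m' ∫_{kδ}^{(k+1)δ} e^{−2(m'+x)|u|} du` and `ψ₀ ≤ ψ(x)`: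
`log π − ψ₀ − C + ρ ≤ log Q₀`, `Q₀ ≤ q` ⇒ `WeilPositivityOnChar χ t`.  Uniform in the values of `χ`; no `ζ` input
(for `m = 1` this is `weilPositivityOnChar_of_joint_cert`). [cite: Weil1952FormulesExplicites, (11) and the «lemme» p. 262] -/
theorem weilPositivityOnChar_of_joint_cert_coprime {q : ℕ} (hq : q ≠ 1) (χ : DirichletCharacter ℂ q) {κ : ℕ}
    (hκ : charParity χ = κ) {m : ℕ} (hm : m ∣ q) {t : ℝ} (ht : 0 < t) {N : ℕ} (hN : Real.exp (2 * t) ≤ (N : ℝ) + 1)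
    {ψ₀ : ℝ} (hψ : ψ₀ ≤ (digamma (((1 / 4 + (κ : ℝ) / 2 : ℝ)) : ℂ)).re)
    {J : ℕ} (hJ : 0 < J) (φ : ℤ → ℝ) {Φ₀ Φ₁ : ℝ} (hΦ₀ : 0 < Φ₀)
    (hφlo : ∀ i, 0 ≤ i → i < (J : ℤ) → Φ₀ ≤ φ i) (hφhi : ∀ i, φ i ≤ Φ₁)
    (hφout : ∀ i, i < 0 ∨ (J : ℤ) ≤ i → φ i = 0) (s : ℕ → ℕ)
    (hs : ∀ n ∈ Finset.range (N + 1),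
      ((s n : ℤ) : ℝ) * (2 * t / J) ≤ Real.log n ∧ Real.log n ≤ (((s n : ℤ) : ℝ) + 1) * (2 * t / J))
    (wbar : ℕ → ℝ)
    (hw : ∀ n ∈ Finset.range (N + 1), (if n.Coprime m then (Λ n : ℝ) / Real.sqrt n else 0) ≤ wbar n)
    (M : ℕ) {k0 K : ℕ} (hk : k0 ≤ K) (Ibar : ℕ → ℝ)
    (hI : ∀ k ∈ Finset.Ico k0 K, ∑ m ∈ Finset.range M,
      ∫ u in ((k : ℝ) * (2 * t / J))..(((k : ℝ) + 1) * (2 * t / J)),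
        Real.exp (-(2 * ((m : ℝ) + (1 / 4 + (κ : ℝ) / 2)) * |u|)) ≤ Ibar k)
    {ρ : ℝ}
    (hcert : ∀ j ∈ Finset.range J,
      ∑ n ∈ Finset.range (N + 1), wbar n *
          (max (φ ((j : ℤ) - s n - 1)) (φ ((j : ℤ) - s n)) + max (φ ((j : ℤ) + s n)) (φ ((j : ℤ) + s n + 1))) +
        ∑ k ∈ Finset.Ico k0 K, Ibar k *
          (max (φ ((j : ℤ) - k - 1)) (φ ((j : ℤ) - k)) + max (φ ((j : ℤ) + k)) (φ ((j : ℤ) + k + 1))) ≤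
        ρ * φ (j : ℤ))
    {C : ℝ} (hC : C ≤ 2 * ∑ k ∈ Finset.Ico k0 K, ∑ m ∈ Finset.range M,
      ∫ u in ((k : ℝ) * (2 * t / J))..(((k : ℝ) + 1) * (2 * t / J)),
        Real.exp (-(2 * ((m : ℝ) + (1 / 4 + (κ : ℝ) / 2)) * |u|)))
    {Q₀ : ℕ} (hQ₀ : 0 < Q₀) (hQ : Q₀ ≤ q) (hB : Real.log π - ψ₀ - C + ρ ≤ Real.log Q₀) :
    WeilPositivityOnChar χ t := by
  refine weilPositivityOnChar_of_trivialKeyFormTrunc_add_killed_nonneg hq χ hκ hm hN M hQ₀ hQ fun g hg hsupp ↦ ?_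
  have hx : (0 : ℝ) < 1 / 4 + (κ : ℝ) / 2 := by positivity
  have hw0 : ∀ n : ℕ, 0 ≤ (if n.Coprime m then (Λ n : ℝ) / Real.sqrt n else 0) := fun n ↦ by
    split_ifs
    · exact div_nonneg ArithmeticFunction.vonMangoldt_nonneg (Real.sqrt_nonneg _)
    · exact le_rfl
  have h := trivialKeyFormTrunc_add_ge_of_joint_cert hg ht hsupp hJ φ hΦ₀ hφlo hφhi hφout N s hs
    (fun n ↦ if n.Coprime m then (Λ n : ℝ) / Real.sqrt n else 0) hw0 wbar hw hx M hk Ibar hI hcert Q₀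
  have hkill : ∑ n ∈ Finset.range (N + 1),
      ((Λ n : ℝ) / Real.sqrt n - (if n.Coprime m then (Λ n : ℝ) / Real.sqrt n else 0)) *
        (2 * ∫ y : ℝ, ‖g y‖ * ‖g (y - Real.log n)‖) =
      ∑ n ∈ Finset.range (N + 1), (if n.Coprime m then 0 else (Λ n : ℝ) / Real.sqrt n) *
        (2 * ∫ y : ℝ, ‖g y‖ * ‖g (y - Real.log n)‖) := by
    refine Finset.sum_congr rfl fun n _ ↦ ?_
    split_ifs <;> ring
  rw [hkill] at h
  have hN20 : 0 ≤ weilNorm2Sq g := integral_nonneg fun _ ↦ by positivity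
  have hcoef : 0 ≤ Real.log Q₀ - Real.log π + (digamma (((1 / 4 + (κ : ℝ) / 2 : ℝ)) : ℂ)).re +
      2 * (∑ k ∈ Finset.Ico k0 K, ∑ m ∈ Finset.range M,
        ∫ u in ((k : ℝ) * (2 * t / J))..(((k : ℝ) + 1) * (2 * t / J)),
          Real.exp (-(2 * ((m : ℝ) + (1 / 4 + (κ : ℝ) / 2)) * |u|))) - ρ := by
    linarith
  exact le_trans (mul_nonneg hcoef hN20) h

end UniformFloor

end Summit.Ventures.WeilGRH

end
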